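import Summits.QuantumFields.BalabanUV.T4Continuum.Support.NE9CurChartOneInstanceDischarged
import Literature.MathematicalPhysics.QuantumFieldTheory.Balaban1983to89.B9Thm311SmallFieldClosed

/-!
# NE9CurChartOneInstanceSmallField — THE T23 «ONE INSTANCE» CHART OF `cur U` (`W80` in the W-slot at the T-slot's own `(H(U), C(U), ε_C)`,
# the J-79 term in the linear slot `Λ := −(𝔊(U) ∘L L_J)`) WITH ITS POSITIVITY `hpos(U)` PRODUCED — NOT DISPLAYED — ON THE SMALL-FIELD SET OF
# A FIXED LATTICE, by the owner's [Balaban1985BackgroundPropagators] Thm 3.11 `B9Thm311SmallFieldClosed.laplaceAofBackground_pos_of_small_field`: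
# the pub-balaban NE9 desk's ARMED trigger T24 «SMALL-FIELD INSTANCE» (PRICING-NE9 v32 §H ∕ v34, «yours [OWNER] or leaf-05's») on route R2′ of
# `t4/ROUTES-NE9.md`; cell `pub-balaban`, T4-DAG §2 node U3 ∕ §6 NE9; NE9 crux-team leaf lineage `b2b-balaban-t4-ne9-formalise-leaf-05`,
# generation 67; Summits-side sequel of `NE9CurChartOneInstance(Discharged)` under this seat's INTERFACE REQUEST NE9 (T24∕T25); nothing printed asserted

HONEST FRAMING (T4-DAG PAGE 1).  Rung (B)+1 of the FINITE-VOLUME T⁴ programme — NOT infinite volume, NOT a mass gap, NOT the Clay problem.  NE9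
(`T4OutputRate.NE9` ∧ `FadingMemory`) is a cell NEW ESTIMATE, NOT PRINTED in [I] = [Balaban1987RG1] (CMP **109**), [II] = [Balaban1988RG2Cluster]
(CMP **116**), and NOT PROVED here («NE9 ⇐ the named binders»; spine PROVED 0∕9).  HONEST DEPENDENCY (cell line, verbatim): continuum YM on T⁴ ⇐
BetaPertH ∧ nine spine estimates (0/9 proved); BetaPertH ⇐ (D1) ∧ (D4) ∧ CAP+tail; G-an2-4 gates asym, D1 and NE2/3/4.  The `cur U` OBJECT is ONE
item of the MODEL O-NE9-1 (species (a) data); the END's `act` ∕ `ker` halves and NEEDS-COORDINATOR #5 are untouched.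

WHY (the row this file closes).  In (B) `NE9CurChartOneInstance.cur_chart_exists_oneInstance` (T23, FIRED v33) and its sequel (C)
`NE9CurChartOneInstanceDischarged` the positivity `hpos : ∀ x ≠ 0, 0 < re⟪x, Δ_a(U)x⟫` of the chain's assembled `Δ_a(U)` ([B9] Thm 3.11) is a
DISPLAYED binder (ABSOLUTE RULE), discharged only at `U = 1` ((C) §2).  The owner's gen-80 chain (A)(B)(C1)(C2)(E) PROVED it at every small
field of a fixed lattice: `laplaceAofBackground_pos_of_small_field` gives ONE threshold `ε₃ > 0` (a finite-lattice number, from the flat coercivity,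
the `R(U)` ∕ `D` ∕ `D*` ∕ `D*D` ∕ `Δ^η_U` remainders, NE9 leaf-03's `Q′(U)` and leaf-04's `Q(U)` Lipschitz letters, and the `4ε`-small curvature)
such that `hpos(U)` HOLDS for every background `U` of E162's data with `‖U(b) − 1‖ ≤ ε ≤ ε₃` and mutually adjoint transporters (`hRS`; or unitary
`U`, tracial `τ`, the norming `⟨φ⁻¹X, φ⁻¹Y⟩ = τ(X*Y)` — `…_unitary`).  His Support v1.3 `NE9CurChartOfBackground.cur_chart_exists_of_small_field`
feeds it to the END's OWN species (`Λ := 0`, `W` free; desk: cell-only).  THIS FILE feeds it to T23's species: the one-instance chart with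
`W80 … ε_C J Δπ` in the W-slot and `Λ := −(𝔊(U) ∘L L_J)`, so that on the small-field set the instance displays NO positivity binder.

WHAT THIS FILE PROVES (0 def, 0 sorry, axioms standard).
* §1 **`cur_chart_exists_oneInstance_smallField`** — `∃ ε₃ > 0` BEFORE `∀ U`: for every `U` of E162's data with `‖U(b) − 1‖ ≤ ε ≤ ε₃` and `hRS`,
  every (L3) letter `ρ`, `τc`, V₀-slot `hqV`, `J`, `Δπ`: `∃ hpos` (PRODUCED) such that — with `H(U) := H1LatticeCLM φ hpos …`, `𝔊(U) := frakGLatticeCLM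
  φ hpos …`, `C(U) := Cc …` — `‖𝔊(U) ∘L L_J‖ < 1 →` the T23 conclusion VERBATIM (`∃ a_C ε_C ε₄ R_b R′ > 0`, the Sect. C `Regime` at
  `(H(U), C(U), a_C, ε_C)` ∧ (Ψ1)–(Ψ3) for `chartHB 𝔊(U) (−(𝔊(U) ∘L LJ ρ τc H(U) C(U) J)) (W80 ρ τc U H(U) C(U) ε_C J Δπ) 0 (A′ ↦ A′ + solA H(U) 0 C(U) 0
  ε_C A′) ε₄ H(U)`).
* §2 **`cur_chart_exists_oneInstance_smallField_structural`** — the same with BOTH remaining displayed slots replaced by STRUCTURE: `hRS` by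
  unitarity + tracial `τ` + the norming (`laplaceAofBackground_pos_of_small_field_unitary`), the V₀-slot `hqV` by NE9 leaf-01's per-lattice letters
  ((C) §1 `cur_chart_exists_oneInstance_structural`: the (31) trace slots `hW`∕`hW′`, `*`-compatible tracial `τc`); `‖U(b)^{±1}‖ ≤ 1` READ OFF `hU1`.
* §3 **`cur_chart_exists_oneInstance_smallField_smallJ`** — §2 with the linear-slot smallness `‖𝔊(U) ∘L L_J‖ < 1` DISCHARGED to «`‖J‖₍₋₃₎ ≤ j₁(U)`»
  (`∃ j₁ > 0` after `∃ hpos`, a finite-lattice, background-dependent number; (B)'s `exists_norm_comp_LJ_le`).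
* §4 **`cur_chart_exists_oneInstance_smallField_kernelRoad`** — T23's SECOND admissible species ((C) §4: `H(U) := HopAd … k_H` in the T-slot, datum
  map `H₁(U) := H1LatticeCLM …`) with `hpos` PRODUCED likewise.
* §5 **`cur_chart_exists_oneInstance_smallField_atLetters₂`** — (C) §3's species (BOTH operator letters of `W` instantiated: `J := Jcur U`,
  `Δπ := deltaPiCLM … (GpOfU … hpos′)` at NE9 leaf-02's THEOREM `laplacePrimeA_pos`, ONE trace `τc := τ`) with `hpos` PRODUCED by (E) `_unitary` from
  the SAME three structure letters (`U(b)* = U(b)⁻¹`, tracial `τ`, the norming) that feed `hpos′` — on the small-field set NEITHER positivity slot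
  ([B9] Thm 3.11 for `Δ_a(U)` and for `Δ′_a(U)`) is displayed.
So on the small-field set of a fixed lattice the T23 object displays: E162's background data, `ε ≤ ε₃`, the fibre∕trace LETTERS `M_φ, M_φ′, C_τ`
(finite-dimensional numbers), STRUCTURE (unitary `U`, tracial `τ`∕`τc`, norming, the (31) slots), the current letters `ρ`, `J`, `Δπ` (or `k_H`),
and `‖𝔊(U) ∘L L_J‖ < 1` (or `‖J‖ ≤ j₁(U)`) — and NO positivity binder.
DISGUISE TEST: composition of landed theorems ((B)(C) of this lineage + the owner's (E)); no inequality of the series proved (`ε₃`, radii, `j₁` are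
finite-lattice ∕ background-dependent numbers; uniformity in the lattice = [B9] Thms 3.12∕3.13, NOT here; `ε₃` is NOT print's uniform threshold);
the Λ-road is ONE of T23's two admissible placements — the chain's road stays the OWNER's decision; not NE9.  SEQUEL (same lineage and generation):
`NE9CurOfOneInstanceChart` — the instance FED to `NE9CurveFromBackgroundMap.cpieceResponse_compCur` (desk T25).
References (TYPES ∕ loci only): [Balaban1985Variational] (47) p. 285, (78)–(80) p. 290, (84)–(90) pp. 290–291, Prop. 4 (97)–(98) pp. 292–293, Prop. 6
(116)–(121) p. 295, (143) p. 300; [Balaban1985BackgroundPropagators] (3.5) p. 391, (3.26) p. 395, Thm 3.11 p. 416, (3.82)–(3.86) p. 407, (3.126) p. 420.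
Imports `NE9CurChartOneInstanceDischarged` (this lineage gen 66) and `B9Thm311SmallFieldClosed` (owner gen 80) ONLY; modifies nothing; no END re-wired.
Value = the desk's T24 object as a NAMED theorem (route R2′ bookkeeping at rung (B)+1), NOT summit progress.
-/

noncomputable section

open Metric Set
open scoped InnerProductSpace

namespace Summit.QuantumFields.BalabanUV.T4Continuum.NE9CurChartOneInstanceSmallField

open Literature.MathematicalPhysics.QuantumFieldTheory.Balaban1983to89
open B11Eq103H1Complex B11Eq115Space B11Eq174Chart
open B11Eq111FrakG (nabla115)
open B11Prop6Scheme (Prop4Hyp)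
open B9Eq319QprimeTorus (fineP)
open B9SectCLatticeCarrier (Bond)
open B4Sect5Torus (TSite)
open B7Prop1Explicit (U1 Wcx boxVec)
open B9Eq315QTorus (perCfg cornerSite QtorusW laplaceAofBackground)
open B9Eq315QTorusOnto (QtorusW_surjective liftSite perSite_liftSite)
open B9Eq310HessianOperator (adTransportW)
open B9Thm311SmallFieldClosed (laplaceAofBackground_pos_of_small_field laplaceAofBackground_pos_of_small_field_unitary)
open B11Eq44COperatorTorus (Cc)
open B11Eq63V0GroupCurrent (curV0)
open B11Eq80Current (W80)
open B11Eq79LinearTerm (LJ)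
open B9Eq39Adjoint (posPlaq plaqU)
open B11Eq90V0primeCurrent (Tsh Ucur)
open B11Eq45HOperator (HopAd)
open Summit.QuantumFields.BalabanUV.T4Continuum.NE9CurChartOneInstance (cur_chart_exists_oneInstance exists_norm_comp_LJ_le)
open Summit.QuantumFields.BalabanUV.T4Continuum.NE9CurChartOneInstanceDischarged
  (cur_chart_exists_oneInstance_structural cur_chart_exists_oneInstance_kernelRoad cur_chart_exists_oneInstance_atLetters₂)
open B9Thm311DeltaPrimeA (laplacePrimeA_pos)
open B9Eq3119DeltaPiCarrier (GpOfU)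
open B11Eq90CurrentAtLetters (W80L)
open B11Eq98CurrentSlot (Jcur)

/-! ## §1 T23's species with `hpos(U)` PRODUCED on the small-field set (V₀-slot and `hRS` displayed) -/

set_option maxRecDepth 8192 in
/-- **THE ONE-INSTANCE CHART OF `cur U` EXISTS AT EVERY SMALL FIELD OF A FIXED LATTICE WITH NO DISPLAYED POSITIVITY** (desk T24): there is
`ε₃ > 0` (a finite-lattice number; the owner's `laplaceAofBackground_pos_of_small_field`, [Balaban1985BackgroundPropagators] Thm 3.11 for the chain's
assembled `Δ_a(U)`) such that for EVERY background `U` of E162's data with `‖U(b) − 1‖ ≤ ε ≤ ε₃` and mutually adjoint transporters `hRS`, and for all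
(L3) letters `ρ`, `τc`, V₀-slot `hqV`, current `J` and `Δπ`, the positivity `hpos(U)` HOLDS (`∃ hpos`) and — at `H(U) := H1LatticeCLM φ hpos …`,
`𝔊(U) := frakGLatticeCLM φ hpos …`, `C(U) := Cc …` — whenever `‖𝔊(U) ∘L L_J‖ < 1`, there are `a_C ε_C ε₄ R_b R′ > 0` with the Sect. C `Regime` of (47)
at `(H(U), C(U), a_C, ε_C)` and (Ψ1)–(Ψ3) for `chartHB 𝔊(U) (−(𝔊(U) ∘L L_J)) (W80 ρ τc U H(U) C(U) ε_C J Δπ) 0 (A′ ↦ A′ + solA H(U) 0 C(U) 0 ε_C A′) ε₄ H(U)`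
— (B)'s `cur_chart_exists_oneInstance` at the produced `hpos`.  Displayed: the fibre∕trace letters `M_φ, M_φ′, C_τ`, `0 < a`. [folklore] -/
theorem cur_chart_exists_oneInstance_smallField {d : ℕ} (L : ℕ) [NeZero L] (m : Fin d → ℕ) [∀ i, NeZero (fineP L m i)] (hL : 1 ≤ L)
    {𝔸 : Type*} [NormedRing 𝔸] [NormedAlgebra ℂ 𝔸] [CompleteSpace 𝔸] [NormOneClass 𝔸] [StarRing 𝔸] [NormedStarGroup 𝔸] [StarModule ℂ 𝔸]
    [FiniteDimensional ℂ 𝔸]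
    {W : Type*} [NormedAddCommGroup W] [InnerProductSpace ℂ W] [FiniteDimensional ℂ W] (φ : W ≃ₗ[ℂ] 𝔸) {Mφ Mφ' : ℝ} (hMφ : 0 ≤ Mφ)
    (hMφ' : 0 ≤ Mφ') (hφ : ∀ w, ‖φ w‖ ≤ Mφ * ‖w‖) (hφ' : ∀ X, ‖φ.symm X‖ ≤ Mφ' * ‖X‖)
    (τ : 𝔸 →ₗ[ℂ] ℂ) {Cτ : ℝ} (hτ : ∀ X, ‖τ X‖ ≤ Cτ * ‖X‖) (hCτ : 0 ≤ Cτ)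
    {η : ℝ} [Fact (0 < (L : ℝ))] [Fact (0 < η)] {lev₀ : Bond d (fineP L m) → ℕ} {levB : Bond d m → ℕ} (lev₁ : Bond d (fineP L m) × Fin d → ℕ)
    (hlev : ∀ b, 1 ≤ lev₀ b) {c₀ c₁ : ℝ} [Fact (0 < c₀)] [Fact (0 < c₁)] {a : ℝ} (ha : 0 < a) :
    ∃ ε₃ : ℝ, 0 < ε₃ ∧ ∀ (U : Bond d (fineP L m) → 𝔸ˣ) {α : ℝ} (hα : α ≤ 1 / 128) (hα1 : α ≤ 1 / 64)
      (hU1 : ∀ (x : B7Prop1Explicit.Site d) (κ : Fin d), perCfg (fineP L m) U x κ ∈ U1 𝔸)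
      (hreg : ∀ (y : TSite d m) (κ : Fin d) (r : Fin d → Fin L),
        ‖((Wcx L (perCfg (fineP L m) U) (cornerSite L y) κ (boxVec L r) : 𝔸ˣ) : 𝔸) - 1‖ ≤ α)
      (hαL : 50 * (d + 1) * α * (L : ℝ) ^ d ≤ 1 / 2) {ε : ℝ}, 0 ≤ ε → ε ≤ ε₃ → (∀ b, ‖(U b : 𝔸) - 1‖ ≤ ε) →
      (∀ (b : Bond d (fineP L m)) (v u : W), inner ℂ (adTransportW φ U b v) u = inner ℂ v (adTransportW φ (fun b => (U b)⁻¹) b u)) →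
      ∀ (ρ : (𝔸 →L[ℂ] ℂ) →L[ℂ] 𝔸) (τc : 𝔸 →L[ℂ] ℂ) {CV RV : ℝ}, 0 ≤ CV → 0 < RV →
        (∀ Y : Space115 (L : ℝ) η lev₀ lev₁ (nabla115 η U), ‖Y‖ < RV →
          ‖curV0 (lev₁ := lev₁) (Dc := nabla115 η U) ρ τc U Y‖ ≤ CV * ‖Y‖ ^ 2) →
      ∀ (J : NegSize (L : ℝ) η lev₀ 3 𝔸) (Δπ : Space115 (L : ℝ) η lev₀ lev₁ (nabla115 η U) →L[ℂ] NegSize (L : ℝ) η lev₀ 3 𝔸),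
      ∃ hpos : ∀ x : BondL2K ℂ d (fineP L m) c₀ W, x ≠ 0 →
          0 < RCLike.re (inner ℂ x (laplaceAofBackground L m hL φ U hα1 hU1 hreg τ η (c₀ := c₀) (c₁ := c₁) a x)),
      let Hc := H1LatticeCLM (lev₀ := lev₀) (levB := levB) φ hpos (QtorusW_surjective L m hL U hα1 hU1 hreg hαL φ) lev₁ (nabla115 η U)
      let Gc := frakGLatticeCLM (lev₀ := lev₀) φ hpos (QtorusW_surjective L m hL U hα1 hU1 hreg hαL φ) lev₁ (nabla115 η U)
      let Cx := Cc L m η U lev₀ lev₁ (nabla115 η U) levB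
      ‖Gc.comp (LJ ρ τc Hc Cx J)‖ < 1 →
      ∃ aC εC ε₄ Rb R' : ℝ, 0 < aC ∧ 0 < εC ∧ 0 < ε₄ ∧ 0 < Rb ∧ 0 < R' ∧
        Regime Hc 0 Cx ‖Hc‖ 0 (2097152 * ((d : ℝ) + 1) ^ 2) (1 / (512 * ((d : ℝ) + 1))) 0 aC εC ∧
        DifferentiableOn ℂ (chartHB Gc (-(Gc.comp (LJ ρ τc Hc Cx J))) (W80 ρ τc U Hc Cx εC J Δπ) 0
            (fun A' => A' + solA Hc 0 Cx 0 εC A') ε₄ Hc) (ball (0 : NegSize (L : ℝ) η levB 0 𝔸) Rb) ∧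
        MapsTo (chartHB Gc (-(Gc.comp (LJ ρ τc Hc Cx J))) (W80 ρ τc U Hc Cx εC J Δπ) 0
            (fun A' => A' + solA Hc 0 Cx 0 εC A') ε₄ Hc) (ball (0 : NegSize (L : ℝ) η levB 0 𝔸) Rb)
            (ball (0 : Space115 (L : ℝ) η lev₀ lev₁ (nabla115 η U)) R') ∧
        chartHB Gc (-(Gc.comp (LJ ρ τc Hc Cx J))) (W80 ρ τc U Hc Cx εC J Δπ) 0
            (fun A' => A' + solA Hc 0 Cx 0 εC A') ε₄ Hc 0 = 0 := by
  obtain ⟨ε₃, hε₃, H⟩ := laplaceAofBackground_pos_of_small_field L m hL φ (c₀ := c₀) (c₁ := c₁) (ne_of_gt (Fact.out : 0 < η)) ha hMφ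
    hMφ' hφ hφ' τ hτ hCτ
  refine ⟨ε₃, hε₃, fun U α hα hα1 hU1 hreg hαL ε hε hεε₃ hUε hRS ρ τc CV RV hCV hRV hqV J Δπ => ?_⟩
  exact ⟨H U hα1 hU1 hreg hε hεε₃ hUε hRS,
    cur_chart_exists_oneInstance L m hL φ τ lev₁ hlev U hα hα1 hU1 hreg hαL a _ ρ τc hCV hRV hqV J Δπ⟩

/-! ## §2 Both remaining slots replaced by STRUCTURE: `hRS` by unitarity ∕ trace ∕ norming, the V₀-slot by NE9 leaf-01's per-lattice letters -/

set_option maxRecDepth 8192 in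
/-- **THE T24 OBJECT WITH STRUCTURE ONLY ON THE W-SIDE AND THE POSITIVITY SIDE**: `∃ ε₃ > 0` such that for EVERY background `U` of E162's data
with `‖U(b) − 1‖ ≤ ε ≤ ε₃`, UNITARY bond variables (`U(b)⁻¹ = U(b)*`), a tracial `τ` norming the fibre (`⟨φ⁻¹X, φ⁻¹Y⟩ = τ(X*Y)` — so `hRS` is the
owner's `hRS_of_unitary`), a `*`-compatible tracial continuous trace `τc` with the (31) slots `hW`∕`hW′` on the W-side (NE9 leaf-01's
`exists_quadAnalytic_W80_structural` via (C) §1), and all current letters `ρ`, `J`, `Δπ`: `hpos(U)` HOLDS and the one-instance chart of `cur U`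
(`W80` at the T-slot's own `(H(U), C(U), ε_C)`, `Λ := −(𝔊(U) ∘L L_J)`) exists whenever `‖𝔊(U) ∘L L_J‖ < 1` — NO positivity binder, NO V₀-slot,
NO `hRS`; `‖U(b)^{±1}‖ ≤ 1` is read off `hU1`. [folklore] -/
theorem cur_chart_exists_oneInstance_smallField_structural {d : ℕ} (L : ℕ) [NeZero L] (m : Fin d → ℕ) [∀ i, NeZero (fineP L m i)]
    (hL : 1 ≤ L)
    {𝔸 : Type*} [NormedRing 𝔸] [NormedAlgebra ℂ 𝔸] [CompleteSpace 𝔸] [NormOneClass 𝔸] [StarRing 𝔸] [NormedStarGroup 𝔸] [StarModule ℂ 𝔸]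
    [FiniteDimensional ℂ 𝔸]
    {W : Type*} [NormedAddCommGroup W] [InnerProductSpace ℂ W] [FiniteDimensional ℂ W] (φ : W ≃ₗ[ℂ] 𝔸) {Mφ Mφ' : ℝ} (hMφ : 0 ≤ Mφ)
    (hMφ' : 0 ≤ Mφ') (hφ : ∀ w, ‖φ w‖ ≤ Mφ * ‖w‖) (hφ' : ∀ X, ‖φ.symm X‖ ≤ Mφ' * ‖X‖)
    (τ : 𝔸 →ₗ[ℂ] ℂ) {Cτ : ℝ} (hτ : ∀ X, ‖τ X‖ ≤ Cτ * ‖X‖) (hCτ : 0 ≤ Cτ)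
    (hτφ : ∀ X Y : 𝔸, ⟪φ.symm X, φ.symm Y⟫_ℂ = τ (star X * Y)) (htr : ∀ X Y : 𝔸, τ (X * Y) = τ (Y * X))
    {η : ℝ} [Fact (0 < (L : ℝ))] [Fact (0 < η)] {lev₀ : Bond d (fineP L m) → ℕ} {levB : Bond d m → ℕ} (lev₁ : Bond d (fineP L m) × Fin d → ℕ)
    (hlev : ∀ b, 1 ≤ lev₀ b) {c₀ c₁ : ℝ} [Fact (0 < c₀)] [Fact (0 < c₁)] {a : ℝ} (ha : 0 < a)
    -- the W-side structure letters: dualising map and a `*`-compatible tracial continuous trace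
    (ρ : (𝔸 →L[ℂ] ℂ) →L[ℂ] 𝔸) (τc : 𝔸 →L[ℂ] ℂ)
    (hτc : ∀ a b : 𝔸, τc (a * b) = τc (b * a)) (hτs : ∀ a : 𝔸, τc (star a) = starRingEnd ℂ (τc a)) :
    ∃ ε₃ : ℝ, 0 < ε₃ ∧ ∀ (U : Bond d (fineP L m) → 𝔸ˣ) {α : ℝ} (hα : α ≤ 1 / 128) (hα1 : α ≤ 1 / 64)
      (hU1 : ∀ (x : B7Prop1Explicit.Site d) (κ : Fin d), perCfg (fineP L m) U x κ ∈ U1 𝔸)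
      (hreg : ∀ (y : TSite d m) (κ : Fin d) (r : Fin d → Fin L),
        ‖((Wcx L (perCfg (fineP L m) U) (cornerSite L y) κ (boxVec L r) : 𝔸ˣ) : 𝔸) - 1‖ ≤ α)
      (hαL : 50 * (d + 1) * α * (L : ℝ) ^ d ≤ 1 / 2) {ε : ℝ}, 0 ≤ ε → ε ≤ ε₃ → (∀ b, ‖(U b : 𝔸) - 1‖ ≤ ε) →
      (∀ b, (((U b)⁻¹ : 𝔸ˣ) : 𝔸) = star (U b : 𝔸)) →
      (∀ q ∈ posPlaq (TSite d (fineP L m)) (Fin d), ∀ Z : 𝔸,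
        ‖(τc : 𝔸 →ₗ[ℂ] ℂ) (Z * (plaqU Tsh (Ucur U) q.2.1 q.2.2 q.1 : 𝔸))‖ ≤ ‖Z‖) →
      (∀ q ∈ posPlaq (TSite d (fineP L m)) (Fin d), ∀ Z : 𝔸,
        ‖(τc : 𝔸 →ₗ[ℂ] ℂ) (Z * (((plaqU Tsh (Ucur U) q.2.1 q.2.2 q.1)⁻¹ : 𝔸ˣ) : 𝔸))‖ ≤ ‖Z‖) →
      ∀ (J : NegSize (L : ℝ) η lev₀ 3 𝔸) (Δπ : Space115 (L : ℝ) η lev₀ lev₁ (nabla115 η U) →L[ℂ] NegSize (L : ℝ) η lev₀ 3 𝔸),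
      ∃ hpos : ∀ x : BondL2K ℂ d (fineP L m) c₀ W, x ≠ 0 →
          0 < RCLike.re (inner ℂ x (laplaceAofBackground L m hL φ U hα1 hU1 hreg τ η (c₀ := c₀) (c₁ := c₁) a x)),
      let Hc := H1LatticeCLM (lev₀ := lev₀) (levB := levB) φ hpos (QtorusW_surjective L m hL U hα1 hU1 hreg hαL φ) lev₁ (nabla115 η U)
      let Gc := frakGLatticeCLM (lev₀ := lev₀) φ hpos (QtorusW_surjective L m hL U hα1 hU1 hreg hαL φ) lev₁ (nabla115 η U)
      let Cx := Cc L m η U lev₀ lev₁ (nabla115 η U) levB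
      ‖Gc.comp (LJ ρ τc Hc Cx J)‖ < 1 →
      ∃ aC εC ε₄ Rb R' : ℝ, 0 < aC ∧ 0 < εC ∧ 0 < ε₄ ∧ 0 < Rb ∧ 0 < R' ∧
        Regime Hc 0 Cx ‖Hc‖ 0 (2097152 * ((d : ℝ) + 1) ^ 2) (1 / (512 * ((d : ℝ) + 1))) 0 aC εC ∧
        DifferentiableOn ℂ (chartHB Gc (-(Gc.comp (LJ ρ τc Hc Cx J))) (W80 ρ τc U Hc Cx εC J Δπ) 0
            (fun A' => A' + solA Hc 0 Cx 0 εC A') ε₄ Hc) (ball (0 : NegSize (L : ℝ) η levB 0 𝔸) Rb) ∧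
        MapsTo (chartHB Gc (-(Gc.comp (LJ ρ τc Hc Cx J))) (W80 ρ τc U Hc Cx εC J Δπ) 0
            (fun A' => A' + solA Hc 0 Cx 0 εC A') ε₄ Hc) (ball (0 : NegSize (L : ℝ) η levB 0 𝔸) Rb)
            (ball (0 : Space115 (L : ℝ) η lev₀ lev₁ (nabla115 η U)) R') ∧
        chartHB Gc (-(Gc.comp (LJ ρ τc Hc Cx J))) (W80 ρ τc U Hc Cx εC J Δπ) 0
            (fun A' => A' + solA Hc 0 Cx 0 εC A') ε₄ Hc 0 = 0 := by
  obtain ⟨ε₃, hε₃, H⟩ := laplaceAofBackground_pos_of_small_field_unitary L m hL φ (c₀ := c₀) (c₁ := c₁) (ne_of_gt (Fact.out : 0 < η)) ha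
    hMφ hMφ' hφ hφ' τ hτ hCτ hτφ htr
  refine ⟨ε₃, hε₃, fun U α hα hα1 hU1 hreg hαL ε hε hεε₃ hUε hU hW hW' J Δπ => ?_⟩
  -- `‖U(b)^{±1}‖ ≤ 1` read off E162's `hU1` (as in the owner's (E))
  have hUn : ∀ b : Bond d (fineP L m), ‖(U b : 𝔸)‖ ≤ 1 ∧ ‖(((U b)⁻¹ : 𝔸ˣ) : 𝔸)‖ ≤ 1 := fun b => by
    obtain ⟨y, κ⟩ := b
    have h := hU1 (liftSite y) κ
    rw [B9Eq315QTorus.perCfg_apply, perSite_liftSite] at h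
    exact B7Prop1Explicit.mem_U1.1 h
  exact ⟨H U hα1 hU1 hreg hε hεε₃ hUε (fun b => (hU b).symm),
    cur_chart_exists_oneInstance_structural L m hL φ τ lev₁ hlev U hα hα1 hU1 hreg hαL a _ ρ τc hU hUn hτc hτs hW hW' J Δπ⟩

/-! ## §3 The linear-slot smallness DISCHARGED to «`‖J‖₍₋₃₎ ≤ j₁(U)`» as well -/

set_option maxRecDepth 8192 in
/-- **§2 FOR ALL SMALL CURRENTS**: on the small-field set of a fixed lattice, with the structure of §2, `hpos(U)` HOLDS and there is a
finite-lattice, BACKGROUND-DEPENDENT threshold `j₁(U) > 0` ((B)'s `exists_norm_comp_LJ_le` at `𝔊(U)`, `H(U)`, `C(U)`) such that for EVERY current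
letter `J` with `‖J‖₍₋₃₎ ≤ j₁(U)` and every `Δπ` the one-instance chart of `cur U` exists — neither `hpos` nor `‖𝔊(U) ∘L L_J‖ < 1` displayed
(print: [Balaban1985Variational] (28) «|J| < C₁B₃ε₁»; uniform `j₁` only with uniform letters — [B9] Thms 3.12∕3.13, NOT here). [folklore] -/
theorem cur_chart_exists_oneInstance_smallField_smallJ {d : ℕ} (L : ℕ) [NeZero L] (m : Fin d → ℕ) [∀ i, NeZero (fineP L m i)]
    (hL : 1 ≤ L)
    {𝔸 : Type*} [NormedRing 𝔸] [NormedAlgebra ℂ 𝔸] [CompleteSpace 𝔸] [NormOneClass 𝔸] [StarRing 𝔸] [NormedStarGroup 𝔸] [StarModule ℂ 𝔸]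
    [FiniteDimensional ℂ 𝔸]
    {W : Type*} [NormedAddCommGroup W] [InnerProductSpace ℂ W] [FiniteDimensional ℂ W] (φ : W ≃ₗ[ℂ] 𝔸) {Mφ Mφ' : ℝ} (hMφ : 0 ≤ Mφ)
    (hMφ' : 0 ≤ Mφ') (hφ : ∀ w, ‖φ w‖ ≤ Mφ * ‖w‖) (hφ' : ∀ X, ‖φ.symm X‖ ≤ Mφ' * ‖X‖)
    (τ : 𝔸 →ₗ[ℂ] ℂ) {Cτ : ℝ} (hτ : ∀ X, ‖τ X‖ ≤ Cτ * ‖X‖) (hCτ : 0 ≤ Cτ)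
    (hτφ : ∀ X Y : 𝔸, ⟪φ.symm X, φ.symm Y⟫_ℂ = τ (star X * Y)) (htr : ∀ X Y : 𝔸, τ (X * Y) = τ (Y * X))
    {η : ℝ} [Fact (0 < (L : ℝ))] [Fact (0 < η)] {lev₀ : Bond d (fineP L m) → ℕ} {levB : Bond d m → ℕ} (lev₁ : Bond d (fineP L m) × Fin d → ℕ)
    (hlev : ∀ b, 1 ≤ lev₀ b) {c₀ c₁ : ℝ} [Fact (0 < c₀)] [Fact (0 < c₁)] {a : ℝ} (ha : 0 < a)
    (ρ : (𝔸 →L[ℂ] ℂ) →L[ℂ] 𝔸) (τc : 𝔸 →L[ℂ] ℂ)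
    (hτc : ∀ a b : 𝔸, τc (a * b) = τc (b * a)) (hτs : ∀ a : 𝔸, τc (star a) = starRingEnd ℂ (τc a)) :
    ∃ ε₃ : ℝ, 0 < ε₃ ∧ ∀ (U : Bond d (fineP L m) → 𝔸ˣ) {α : ℝ} (hα : α ≤ 1 / 128) (hα1 : α ≤ 1 / 64)
      (hU1 : ∀ (x : B7Prop1Explicit.Site d) (κ : Fin d), perCfg (fineP L m) U x κ ∈ U1 𝔸)
      (hreg : ∀ (y : TSite d m) (κ : Fin d) (r : Fin d → Fin L),
        ‖((Wcx L (perCfg (fineP L m) U) (cornerSite L y) κ (boxVec L r) : 𝔸ˣ) : 𝔸) - 1‖ ≤ α)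
      (hαL : 50 * (d + 1) * α * (L : ℝ) ^ d ≤ 1 / 2) {ε : ℝ}, 0 ≤ ε → ε ≤ ε₃ → (∀ b, ‖(U b : 𝔸) - 1‖ ≤ ε) →
      (∀ b, (((U b)⁻¹ : 𝔸ˣ) : 𝔸) = star (U b : 𝔸)) →
      (∀ q ∈ posPlaq (TSite d (fineP L m)) (Fin d), ∀ Z : 𝔸,
        ‖(τc : 𝔸 →ₗ[ℂ] ℂ) (Z * (plaqU Tsh (Ucur U) q.2.1 q.2.2 q.1 : 𝔸))‖ ≤ ‖Z‖) →
      (∀ q ∈ posPlaq (TSite d (fineP L m)) (Fin d), ∀ Z : 𝔸,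
        ‖(τc : 𝔸 →ₗ[ℂ] ℂ) (Z * (((plaqU Tsh (Ucur U) q.2.1 q.2.2 q.1)⁻¹ : 𝔸ˣ) : 𝔸))‖ ≤ ‖Z‖) →
      ∃ hpos : ∀ x : BondL2K ℂ d (fineP L m) c₀ W, x ≠ 0 →
          0 < RCLike.re (inner ℂ x (laplaceAofBackground L m hL φ U hα1 hU1 hreg τ η (c₀ := c₀) (c₁ := c₁) a x)),
      let Hc := H1LatticeCLM (lev₀ := lev₀) (levB := levB) φ hpos (QtorusW_surjective L m hL U hα1 hU1 hreg hαL φ) lev₁ (nabla115 η U)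
      let Gc := frakGLatticeCLM (lev₀ := lev₀) φ hpos (QtorusW_surjective L m hL U hα1 hU1 hreg hαL φ) lev₁ (nabla115 η U)
      let Cx := Cc L m η U lev₀ lev₁ (nabla115 η U) levB
      ∃ j₁ : ℝ, 0 < j₁ ∧ ∀ (J : NegSize (L : ℝ) η lev₀ 3 𝔸)
        (Δπ : Space115 (L : ℝ) η lev₀ lev₁ (nabla115 η U) →L[ℂ] NegSize (L : ℝ) η lev₀ 3 𝔸), ‖J‖ ≤ j₁ →
      ∃ aC εC ε₄ Rb R' : ℝ, 0 < aC ∧ 0 < εC ∧ 0 < ε₄ ∧ 0 < Rb ∧ 0 < R' ∧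
        Regime Hc 0 Cx ‖Hc‖ 0 (2097152 * ((d : ℝ) + 1) ^ 2) (1 / (512 * ((d : ℝ) + 1))) 0 aC εC ∧
        DifferentiableOn ℂ (chartHB Gc (-(Gc.comp (LJ ρ τc Hc Cx J))) (W80 ρ τc U Hc Cx εC J Δπ) 0
            (fun A' => A' + solA Hc 0 Cx 0 εC A') ε₄ Hc) (ball (0 : NegSize (L : ℝ) η levB 0 𝔸) Rb) ∧
        MapsTo (chartHB Gc (-(Gc.comp (LJ ρ τc Hc Cx J))) (W80 ρ τc U Hc Cx εC J Δπ) 0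
            (fun A' => A' + solA Hc 0 Cx 0 εC A') ε₄ Hc) (ball (0 : NegSize (L : ℝ) η levB 0 𝔸) Rb)
            (ball (0 : Space115 (L : ℝ) η lev₀ lev₁ (nabla115 η U)) R') ∧
        chartHB Gc (-(Gc.comp (LJ ρ τc Hc Cx J))) (W80 ρ τc U Hc Cx εC J Δπ) 0
            (fun A' => A' + solA Hc 0 Cx 0 εC A') ε₄ Hc 0 = 0 := by
  obtain ⟨ε₃, hε₃, H⟩ := cur_chart_exists_oneInstance_smallField_structural L m hL φ hMφ hMφ' hφ hφ' τ hτ hCτ hτφ htr (η := η)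
    (lev₀ := lev₀) (levB := levB) lev₁ hlev (c₀ := c₀) (c₁ := c₁) ha ρ τc hτc hτs
  refine ⟨ε₃, hε₃, fun U α hα hα1 hU1 hreg hαL ε hε hεε₃ hUε hU hW hW' => ?_⟩
  -- `hpos` does not depend on the current letters: read it off the instance at `J := 0`, `Δπ := 0`
  obtain ⟨hpos, -⟩ := H U hα hα1 hU1 hreg hαL hε hεε₃ hUε hU hW hW' 0 0
  refine ⟨hpos, ?_⟩
  intro Hc Gc Cx
  obtain ⟨K, hK0, hK⟩ := exists_norm_comp_LJ_le Gc ρ τc Hc Cx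
  refine ⟨1 / (2 * (K + 1)), by positivity, fun J Δπ hJ => ?_⟩
  have hθ : ‖Gc.comp (LJ ρ τc Hc Cx J)‖ < 1 := by
    have h1 : ‖Gc.comp (LJ ρ τc Hc Cx J)‖ ≤ K * ‖J‖ := hK J
    have h2 : K * ‖J‖ ≤ K * (1 / (2 * (K + 1))) := mul_le_mul_of_nonneg_left hJ hK0
    have h3 : K * (1 / (2 * (K + 1))) < 1 := by
      rw [mul_one_div, div_lt_one (by positivity)]; linarith
    linarith
  obtain ⟨hpos', h'⟩ := H U hα hα1 hU1 hreg hαL hε hεε₃ hUε hU hW hW' J Δπ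
  exact h' hθ

/-! ## §4 T23's second admissible species (the kernel road, (C) §4) with `hpos` PRODUCED -/

set_option maxRecDepth 8192 in
/-- **THE KERNEL-ROAD SPECIES AT EVERY SMALL FIELD WITH NO DISPLAYED POSITIVITY**: `∃ ε₃ > 0` such that for EVERY `U` of E162's data with
`‖U(b) − 1‖ ≤ ε ≤ ε₃` and `hRS`, every kernel datum `k_H` (NE9 leaf-03's (L4) reading of [Balaban1985Variational] (45): `H(U) := HopAd … k_H` in the
T-slot, in `W80` and in `L_J`), (L3) letters `ρ`, `τc`, V₀-slot `hqV`, `J`, `Δπ`: `hpos(U)` HOLDS and — with the datum map `H₁(U) := H1LatticeCLM φ hpos …`,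
`𝔊(U) := frakGLatticeCLM φ hpos …`, `C(U) := Cc …` — whenever `‖𝔊(U) ∘L L_J‖ < 1` the chart of (C) §4 `cur_chart_exists_oneInstance_kernelRoad` exists.
[folklore] -/
theorem cur_chart_exists_oneInstance_smallField_kernelRoad {d : ℕ} (L : ℕ) [NeZero L] (m : Fin d → ℕ) [∀ i, NeZero (fineP L m i)]
    (hL : 1 ≤ L)
    {𝔸 : Type*} [NormedRing 𝔸] [NormedAlgebra ℂ 𝔸] [CompleteSpace 𝔸] [NormOneClass 𝔸] [StarRing 𝔸] [NormedStarGroup 𝔸] [StarModule ℂ 𝔸]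
    [FiniteDimensional ℂ 𝔸]
    {W : Type*} [NormedAddCommGroup W] [InnerProductSpace ℂ W] [FiniteDimensional ℂ W] (φ : W ≃ₗ[ℂ] 𝔸) {Mφ Mφ' : ℝ} (hMφ : 0 ≤ Mφ)
    (hMφ' : 0 ≤ Mφ') (hφ : ∀ w, ‖φ w‖ ≤ Mφ * ‖w‖) (hφ' : ∀ X, ‖φ.symm X‖ ≤ Mφ' * ‖X‖)
    (τ : 𝔸 →ₗ[ℂ] ℂ) {Cτ : ℝ} (hτ : ∀ X, ‖τ X‖ ≤ Cτ * ‖X‖) (hCτ : 0 ≤ Cτ)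
    {η : ℝ} [Fact (0 < (L : ℝ))] [Fact (0 < η)] {lev₀ : Bond d (fineP L m) → ℕ} {levB : Bond d m → ℕ} (lev₁ : Bond d (fineP L m) × Fin d → ℕ)
    (hlev : ∀ b, 1 ≤ lev₀ b) {c₀ c₁ : ℝ} [Fact (0 < c₀)] [Fact (0 < c₁)] {a : ℝ} (ha : 0 < a) :
    ∃ ε₃ : ℝ, 0 < ε₃ ∧ ∀ (U : Bond d (fineP L m) → 𝔸ˣ) {α : ℝ} (hα : α ≤ 1 / 128) (hα1 : α ≤ 1 / 64)
      (hU1 : ∀ (x : B7Prop1Explicit.Site d) (κ : Fin d), perCfg (fineP L m) U x κ ∈ U1 𝔸)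
      (hreg : ∀ (y : TSite d m) (κ : Fin d) (r : Fin d → Fin L),
        ‖((Wcx L (perCfg (fineP L m) U) (cornerSite L y) κ (boxVec L r) : 𝔸ˣ) : 𝔸) - 1‖ ≤ α)
      (hαL : 50 * (d + 1) * α * (L : ℝ) ^ d ≤ 1 / 2) {ε : ℝ}, 0 ≤ ε → ε ≤ ε₃ → (∀ b, ‖(U b : 𝔸) - 1‖ ≤ ε) →
      (∀ (b : Bond d (fineP L m)) (v u : W), inner ℂ (adTransportW φ U b v) u = inner ℂ v (adTransportW φ (fun b => (U b)⁻¹) b u)) →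
      ∀ (kH : Bond d (fineP L m) → Bond d m → (𝔸 →L[ℂ] 𝔸))
        (ρ : (𝔸 →L[ℂ] ℂ) →L[ℂ] 𝔸) (τc : 𝔸 →L[ℂ] ℂ) {CV RV : ℝ}, 0 ≤ CV → 0 < RV →
        (∀ Y : Space115 (L : ℝ) η lev₀ lev₁ (nabla115 η U), ‖Y‖ < RV →
          ‖curV0 (lev₁ := lev₁) (Dc := nabla115 η U) ρ τc U Y‖ ≤ CV * ‖Y‖ ^ 2) →
      ∀ (J : NegSize (L : ℝ) η lev₀ 3 𝔸) (Δπ : Space115 (L : ℝ) η lev₀ lev₁ (nabla115 η U) →L[ℂ] NegSize (L : ℝ) η lev₀ 3 𝔸),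
      ∃ hpos : ∀ x : BondL2K ℂ d (fineP L m) c₀ W, x ≠ 0 →
          0 < RCLike.re (inner ℂ x (laplaceAofBackground L m hL φ U hα1 hU1 hreg τ η (c₀ := c₀) (c₁ := c₁) a x)),
      let Hk := HopAd (L : ℝ) η levB lev₀ lev₁ U kH
      let H₁ := H1LatticeCLM (lev₀ := lev₀) (levB := levB) φ hpos (QtorusW_surjective L m hL U hα1 hU1 hreg hαL φ) lev₁ (nabla115 η U)
      let Gc := frakGLatticeCLM (lev₀ := lev₀) φ hpos (QtorusW_surjective L m hL U hα1 hU1 hreg hαL φ) lev₁ (nabla115 η U)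
      let Cx := Cc L m η U lev₀ lev₁ (nabla115 η U) levB
      ‖Gc.comp (LJ ρ τc Hk Cx J)‖ < 1 →
      ∃ aC εC ε₄ Rb R' : ℝ, 0 < aC ∧ 0 < εC ∧ 0 < ε₄ ∧ 0 < Rb ∧ 0 < R' ∧
        Regime Hk 0 Cx ‖Hk‖ 0 (2097152 * ((d : ℝ) + 1) ^ 2) (1 / (512 * ((d : ℝ) + 1))) 0 aC εC ∧
        DifferentiableOn ℂ (chartHB Gc (-(Gc.comp (LJ ρ τc Hk Cx J))) (W80 ρ τc U Hk Cx εC J Δπ) 0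
            (fun A' => A' + solA Hk 0 Cx 0 εC A') ε₄ H₁) (ball (0 : NegSize (L : ℝ) η levB 0 𝔸) Rb) ∧
        MapsTo (chartHB Gc (-(Gc.comp (LJ ρ τc Hk Cx J))) (W80 ρ τc U Hk Cx εC J Δπ) 0
            (fun A' => A' + solA Hk 0 Cx 0 εC A') ε₄ H₁) (ball (0 : NegSize (L : ℝ) η levB 0 𝔸) Rb)
            (ball (0 : Space115 (L : ℝ) η lev₀ lev₁ (nabla115 η U)) R') ∧
        chartHB Gc (-(Gc.comp (LJ ρ τc Hk Cx J))) (W80 ρ τc U Hk Cx εC J Δπ) 0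
            (fun A' => A' + solA Hk 0 Cx 0 εC A') ε₄ H₁ 0 = 0 := by
  obtain ⟨ε₃, hε₃, H⟩ := laplaceAofBackground_pos_of_small_field L m hL φ (c₀ := c₀) (c₁ := c₁) (ne_of_gt (Fact.out : 0 < η)) ha hMφ
    hMφ' hφ hφ' τ hτ hCτ
  refine ⟨ε₃, hε₃, fun U α hα hα1 hU1 hreg hαL ε hε hεε₃ hUε hRS kH ρ τc CV RV hCV hRV hqV J Δπ => ?_⟩
  exact ⟨H U hα1 hU1 hreg hε hεε₃ hUε hRS,
    cur_chart_exists_oneInstance_kernelRoad L m hL φ τ lev₁ hlev U hα hα1 hU1 hreg hαL a _ kH ρ τc hCV hRV hqV J Δπ⟩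

/-! ## §5 (C) §3's species — BOTH operator letters of `W` instantiated, ONE trace — with BOTH positivity slots PRODUCED from the structure letters -/

set_option maxRecDepth 8192 in
/-- **THE T23 OBJECT AT THE LETTERS WITH NO DISPLAYED POSITIVITY AT ALL ON THE SMALL-FIELD SET**: `∃ ε₃ > 0` such that for EVERY background `U` of
E162's data with `‖U(b) − 1‖ ≤ ε ≤ ε₃` and UNITARY bond variables, given a tracial `τ` norming the fibre (`⟨φ⁻¹X, φ⁻¹Y⟩ = τ(X*Y)`), `0 < a`, `0 < a′`,
the dualising map `ρ` and the V₀-slot at `τc := τ`: the Hessian's positivity `hpos(U)` HOLDS (the owner's (E) `laplaceAofBackground_pos_of_small_field_unitary`)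
and — with `hpos′ := laplacePrimeA_pos …` (NE9 leaf-02's theorem for `Δ′_a(U)`, from the SAME three structure letters), `H(U)`, `𝔊(U)`, `C(U)` as before —
whenever `‖𝔊(U) ∘L L_{Jcur U}‖ < 1` the chart of (C) §3 `cur_chart_exists_oneInstance_atLetters₂` exists: W-slot
`W80L L m φ U (GpOfU … hpos′) lev₁ (nabla115 η U) ρ τc H(U) C(U) ε_C`, `Λ := −(𝔊(U) ∘L L_{Jcur U})`. [folklore] -/
theorem cur_chart_exists_oneInstance_smallField_atLetters₂ {d : ℕ} (L : ℕ) [NeZero L] (m : Fin d → ℕ) [∀ i, NeZero (fineP L m i)]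
    (hL : 1 ≤ L)
    {𝔸 : Type*} [NormedRing 𝔸] [NormedAlgebra ℂ 𝔸] [CompleteSpace 𝔸] [NormOneClass 𝔸] [StarRing 𝔸] [NormedStarGroup 𝔸] [StarModule ℂ 𝔸]
    [FiniteDimensional ℂ 𝔸]
    {W : Type*} [NormedAddCommGroup W] [InnerProductSpace ℂ W] [FiniteDimensional ℂ W] (φ : W ≃ₗ[ℂ] 𝔸) {Mφ Mφ' : ℝ} (hMφ : 0 ≤ Mφ)
    (hMφ' : 0 ≤ Mφ') (hφ : ∀ w, ‖φ w‖ ≤ Mφ * ‖w‖) (hφ' : ∀ X, ‖φ.symm X‖ ≤ Mφ' * ‖X‖)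
    (τ : 𝔸 →ₗ[ℂ] ℂ) {Cτ : ℝ} (hτ : ∀ X, ‖τ X‖ ≤ Cτ * ‖X‖) (hCτ : 0 ≤ Cτ)
    (hτφ : ∀ X Y : 𝔸, ⟪φ.symm X, φ.symm Y⟫_ℂ = τ (star X * Y)) (htr : ∀ X Y : 𝔸, τ (X * Y) = τ (Y * X))
    {η : ℝ} [Fact (0 < (L : ℝ))] [Fact (0 < η)] {lev₀ : Bond d (fineP L m) → ℕ} {levB : Bond d m → ℕ} (lev₁ : Bond d (fineP L m) × Fin d → ℕ)
    (hlev : ∀ b, 1 ≤ lev₀ b) {c₀ c₁ : ℝ} [Fact (0 < c₀)] [Fact (0 < c₁)] {a : ℝ} (ha : 0 < a) {a' : ℝ} (ha' : 0 < a') :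
    ∃ ε₃ : ℝ, 0 < ε₃ ∧ ∀ (U : Bond d (fineP L m) → 𝔸ˣ) {α : ℝ} (hα : α ≤ 1 / 128) (hα1 : α ≤ 1 / 64)
      (hU1 : ∀ (x : B7Prop1Explicit.Site d) (κ : Fin d), perCfg (fineP L m) U x κ ∈ U1 𝔸)
      (hreg : ∀ (y : TSite d m) (κ : Fin d) (r : Fin d → Fin L),
        ‖((Wcx L (perCfg (fineP L m) U) (cornerSite L y) κ (boxVec L r) : 𝔸ˣ) : 𝔸) - 1‖ ≤ α)
      (hαL : 50 * (d + 1) * α * (L : ℝ) ^ d ≤ 1 / 2) {ε : ℝ}, 0 ≤ ε → ε ≤ ε₃ → (∀ b, ‖(U b : 𝔸) - 1‖ ≤ ε) →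
      ∀ (hU : ∀ b, star (U b : 𝔸) = (((U b)⁻¹ : 𝔸ˣ) : 𝔸))
        (ρ : (𝔸 →L[ℂ] ℂ) →L[ℂ] 𝔸) {CV RV : ℝ}, 0 ≤ CV → 0 < RV →
        (∀ Y : Space115 (L : ℝ) η lev₀ lev₁ (nabla115 η U), ‖Y‖ < RV →
          ‖curV0 (lev₁ := lev₁) (Dc := nabla115 η U) ρ (LinearMap.toContinuousLinearMap τ) U Y‖ ≤ CV * ‖Y‖ ^ 2) →
      ∃ hpos : ∀ x : BondL2K ℂ d (fineP L m) c₀ W, x ≠ 0 →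
          0 < RCLike.re (inner ℂ x (laplaceAofBackground L m hL φ U hα1 hU1 hreg τ η (c₀ := c₀) (c₁ := c₁) a x)),
      let hpos' := laplacePrimeA_pos L m φ η U a' (c₁ := c₁) τ htr hτφ hU (ne_of_gt (Fact.out : 0 < η)) ha'
      let Hc := H1LatticeCLM (lev₀ := lev₀) (levB := levB) φ hpos (QtorusW_surjective L m hL U hα1 hU1 hreg hαL φ) lev₁ (nabla115 η U)
      let Gc := frakGLatticeCLM (lev₀ := lev₀) φ hpos (QtorusW_surjective L m hL U hα1 hU1 hreg hαL φ) lev₁ (nabla115 η U)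
      let Cx := Cc L m η U lev₀ lev₁ (nabla115 η U) levB
      ‖Gc.comp (LJ ρ (LinearMap.toContinuousLinearMap τ) Hc Cx (Jcur (L := (L : ℝ)) (η := η) (lev₀ := lev₀) U))‖ < 1 →
      ∃ aC εC ε₄ Rb R' : ℝ, 0 < aC ∧ 0 < εC ∧ 0 < ε₄ ∧ 0 < Rb ∧ 0 < R' ∧
        Regime Hc 0 Cx ‖Hc‖ 0 (2097152 * ((d : ℝ) + 1) ^ 2) (1 / (512 * ((d : ℝ) + 1))) 0 aC εC ∧
        DifferentiableOn ℂ (chartHB Gc (-(Gc.comp (LJ ρ (LinearMap.toContinuousLinearMap τ) Hc Cx (Jcur (L := (L : ℝ)) (η := η) (lev₀ := lev₀) U))))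
            (W80L L m φ (Lr := (L : ℝ)) (η := η) U (GpOfU L m φ η U a' (c₀ := c₀) (c₁ := c₁) hpos') lev₁ (nabla115 η U) ρ
              (LinearMap.toContinuousLinearMap τ) Hc Cx εC) 0
            (fun A' => A' + solA Hc 0 Cx 0 εC A') ε₄ Hc) (ball (0 : NegSize (L : ℝ) η levB 0 𝔸) Rb) ∧
        MapsTo (chartHB Gc (-(Gc.comp (LJ ρ (LinearMap.toContinuousLinearMap τ) Hc Cx (Jcur (L := (L : ℝ)) (η := η) (lev₀ := lev₀) U))))
            (W80L L m φ (Lr := (L : ℝ)) (η := η) U (GpOfU L m φ η U a' (c₀ := c₀) (c₁ := c₁) hpos') lev₁ (nabla115 η U) ρ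
              (LinearMap.toContinuousLinearMap τ) Hc Cx εC) 0
            (fun A' => A' + solA Hc 0 Cx 0 εC A') ε₄ Hc) (ball (0 : NegSize (L : ℝ) η levB 0 𝔸) Rb)
            (ball (0 : Space115 (L : ℝ) η lev₀ lev₁ (nabla115 η U)) R') ∧
        chartHB Gc (-(Gc.comp (LJ ρ (LinearMap.toContinuousLinearMap τ) Hc Cx (Jcur (L := (L : ℝ)) (η := η) (lev₀ := lev₀) U))))
            (W80L L m φ (Lr := (L : ℝ)) (η := η) U (GpOfU L m φ η U a' (c₀ := c₀) (c₁ := c₁) hpos') lev₁ (nabla115 η U) ρ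
              (LinearMap.toContinuousLinearMap τ) Hc Cx εC) 0
            (fun A' => A' + solA Hc 0 Cx 0 εC A') ε₄ Hc 0 = 0 := by
  obtain ⟨ε₃, hε₃, H⟩ := laplaceAofBackground_pos_of_small_field_unitary L m hL φ (c₀ := c₀) (c₁ := c₁) (ne_of_gt (Fact.out : 0 < η)) ha
    hMφ hMφ' hφ hφ' τ hτ hCτ hτφ htr
  refine ⟨ε₃, hε₃, fun U α hα hα1 hU1 hreg hαL ε hε hεε₃ hUε hU ρ CV RV hCV hRV hqV => ?_⟩
  exact ⟨H U hα1 hU1 hreg hε hεε₃ hUε hU,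
    cur_chart_exists_oneInstance_atLetters₂ L m hL φ τ lev₁ hlev U hα hα1 hU1 hreg hαL a _ htr hτφ hU ha' ρ hCV hRV hqV⟩

end Summit.QuantumFields.BalabanUV.T4Continuum.NE9CurChartOneInstanceSmallField

end
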